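import Mathlib.Analysis.SpecialFunctions.Pow.Integral
import Mathlib.Analysis.SpecialFunctions.JapaneseBracket
import Mathlib.MeasureTheory.Measure.Lebesgue.EqHaar
import Mathlib.MeasureTheory.Measure.Haar.InnerProductSpace
import Mathlib.MeasureTheory.Measure.Haar.NormedSpace
import Mathlib.MeasureTheory.Integral.MeanInequalities
import Mathlib.Analysis.InnerProductSpace.PiL2
import HarnessLib

/-!
# Riesz-kernel integrals on `ℝ³`: local and exterior integrability, scaling, two-centre bounds

Analysis/FluidPDE support file (all results proved; pure measure theory on
`ℝ³ = EuclideanSpace ℝ (Fin 3)` with Lebesgue measure) for the discharge of the named fact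
`Literature.Analysis.FluidPDE.tsai1998_lemma33` (Tsai 1998, Lemma 3.3: `U ∈ L^q`, `3 < q < ∞`
⟹ `U = o(|y|)` for Leray profiles; file `TsaiGrowthLemmasProofs`). The bootstrap there trades the
singular weight `|y − y₀|^{-β}` against the `L^q`-smallness of `U` through Hölder's inequality,
and needs the following facts about the kernels `powKer s x = |x|^{-s}` (as `ℝ≥0∞`-valued
functions, `RieszKernel.powKer`):

* `lintegral_ball_powKer_lt_top`, `lintegral_closedBall_powKer_sub_lt_top`: `|x|^{-s}` is
  integrable on balls for `s < 3` (Mathlib's `integrableOn_ball_of_norm_le_rpow`, i.e. polar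
  coordinates), with translation invariance (`setLIntegral_(closed)Ball_comp_sub`);
* `lintegral_compl_ball_powKer_lt_top`: `|x|^{-s}` is integrable off balls for `s > 3`
  (comparison with `(1+|x|)^{-s}`, Mathlib's `finite_integral_one_add_norm`);
* `lintegral_comp_smul`: `∫ f(cx) dx = c⁻³ ∫ f` (`Measure.map_addHaar_smul`);
* `exists_lintegral_powKer_mul_powKer_le` — **the Riesz composition bound**: for
  `0 ≤ a, b < 3 < a + b` there is `K < ∞` with `∫ |x|^{-a}|x − w|^{-b} dx ≤ K |w|^{3−a−b}` for all
  `w ≠ 0` (scaling to `|w| = 1` and the three-region split `|u| ≤ ½`, `|u − e| ≤ ½`,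
  `|u − e| ≥ |u|/4`; Stein, *Singular integrals*, V §1 (the composition of Riesz potentials));
* `exists_setLIntegral_powKer_mul_powKer_le` — the bounded case `a + b < 3` on balls, uniformly in
  both centres (Hölder with the conjugate exponents `(a+b)/a`, `(a+b)/b`).

## References

* E. M. Stein, *Singular integrals and differentiability properties of functions*, Princeton
  (1970), Ch. V §1.1 (Riesz potentials and their composition). [folklore]
* T.-P. Tsai, *On Leray's self-similar solutions of the Navier–Stokes equations satisfying local
  energy estimates*, Arch. Rational Mech. Anal. 143 (1998) 29–51, §3.3 [Tsai1998].
-/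

noncomputable section

open MeasureTheory Set Filter Topology Function Real Metric
open scoped ENNReal BigOperators

namespace Literature.Analysis.FluidPDE

namespace RieszKernel

/-- Local notation for physical space `ℝ³ = EuclideanSpace ℝ (Fin 3)`. -/
local notation "𝔼" => EuclideanSpace ℝ (Fin 3)

/-- The Riesz-type kernel `|x|^{-s}` as an extended non-negative real (`0` at the origin for
`s ≠ 0`, by Mathlib's convention `0 ^ (-s) = 0`). [folklore] -/
def powKer (s : ℝ) (x : 𝔼) : ℝ≥0∞ := ENNReal.ofReal (‖x‖ ^ (-s))

/-- `finrank ℝ ℝ³ = 3`. [folklore] -/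
theorem finrank_eq_three : Module.finrank ℝ 𝔼 = 3 := by
  rw [finrank_euclideanSpace, Fintype.card_fin]

/-- `powKer s` is measurable. [folklore] -/
theorem measurable_powKer (s : ℝ) : Measurable (powKer s) :=
  ((measurable_norm.pow_const _).ennreal_ofReal)

/-- `powKer s (· − w)` is measurable. [folklore] -/
theorem measurable_powKer_sub (s : ℝ) (w : 𝔼) : Measurable fun x => powKer s (x - w) :=
  (measurable_powKer s).comp (measurable_id.sub measurable_const)

/-- Unfolding. [folklore] -/
theorem powKer_apply (s : ℝ) (x : 𝔼) : powKer s x = ENNReal.ofReal (‖x‖ ^ (-s)) := rfl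

/-- The kernel is even: `|−x|^{-s} = |x|^{-s}`. [folklore] -/
@[simp] theorem powKer_neg (s : ℝ) (x : 𝔼) : powKer s (-x) = powKer s x := by
  rw [powKer, powKer, norm_neg]

/-- Symmetry in two-point form: `|x − y|^{-s} = |y − x|^{-s}`. [folklore] -/
theorem powKer_sub_comm (s : ℝ) (x y : 𝔼) : powKer s (x - y) = powKer s (y - x) := by
  rw [← powKer_neg, neg_sub]

/-- Monotonicity in the radius: `|y|^{-s} ≤ |x|^{-s}` for `0 < |x| ≤ |y|`, `s ≥ 0`. [folklore] -/
theorem powKer_le_of_norm_le {s : ℝ} (hs : 0 ≤ s) {x y : 𝔼} (hx : x ≠ 0) (hxy : ‖x‖ ≤ ‖y‖) :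
    powKer s y ≤ powKer s x :=
  ENNReal.ofReal_le_ofReal (Real.rpow_le_rpow_of_nonpos (norm_pos_iff.2 hx) hxy (by linarith))

/-- `|x|^{-s} ≤ r^{-s}` when `r ≤ |x|`, `0 < r`, `0 ≤ s`. [folklore] -/
theorem powKer_le_const {s : ℝ} (hs : 0 ≤ s) {r : ℝ} (hr : 0 < r) {x : 𝔼} (hx : r ≤ ‖x‖) :
    powKer s x ≤ ENNReal.ofReal (r ^ (-s)) :=
  ENNReal.ofReal_le_ofReal (Real.rpow_le_rpow_of_nonpos hr hx (by linarith))

/-- Scaling of the kernel: `|c x|^{-s} = c^{-s} |x|^{-s}` for `c > 0`. [folklore] -/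
theorem powKer_smul {s c : ℝ} (hc : 0 < c) (x : 𝔼) :
    powKer s (c • x) = ENNReal.ofReal (c ^ (-s)) * powKer s x := by
  rw [powKer, powKer, norm_smul, Real.norm_eq_abs, abs_of_pos hc, Real.mul_rpow hc.le (norm_nonneg _),
    ENNReal.ofReal_mul (Real.rpow_nonneg hc.le _)]

/-- Products of kernels with the same centre add the exponents: `|x|^{-a} |x|^{-b} = |x|^{-(a+b)}`
off the origin. [folklore] -/
theorem powKer_mul_powKer {a b : ℝ} {x : 𝔼} (hx : x ≠ 0) : powKer a x * powKer b x = powKer (a + b) x := by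
  rw [powKer, powKer, powKer, ← ENNReal.ofReal_mul (Real.rpow_nonneg (norm_nonneg _) _), neg_add,
    Real.rpow_add (norm_pos_iff.2 hx)]

/-- Powers of the kernel multiply the exponent: `(|x|^{-a})^t = |x|^{-at}` for `t ≥ 0`. [folklore] -/
theorem powKer_rpow {a t : ℝ} (ht : 0 ≤ t) (x : 𝔼) : powKer a x ^ t = powKer (a * t) x := by
  rw [powKer, powKer, ENNReal.ofReal_rpow_of_nonneg (Real.rpow_nonneg (norm_nonneg _) _) ht,
    ← Real.rpow_mul (norm_nonneg _), neg_mul]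

/-! ### Local integrability (`s < 3`) and exterior integrability (`s > 3`) -/

/-- **`|x|^{-s}` is integrable on balls of `ℝ³` for `s < 3`** (Mathlib's
`integrableOn_ball_of_norm_le_rpow`, polar coordinates). [folklore] -/
theorem lintegral_ball_powKer_lt_top {s : ℝ} (hs : s < 3) (R : ℝ) :
    ∫⁻ x in ball (0 : 𝔼) R, powKer s x < ⊤ := by
  have hint : IntegrableOn (fun x : 𝔼 => ‖x‖ ^ (-s)) (ball 0 R) := by
    refine integrableOn_ball_of_norm_le_rpow (μ := volume) (by rw [finrank_eq_three]; norm_num) (C := 1)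
      (by rw [finrank_eq_three]; exact_mod_cast hs) (Eventually.of_forall fun x => ?_) ?_
    · rw [Real.norm_eq_abs, abs_of_nonneg (Real.rpow_nonneg (norm_nonneg _) _), one_mul]
    · exact (measurable_norm.pow_const _).aestronglyMeasurable
  exact hint.setLIntegral_lt_top

/-- Translation invariance for kernel integrals over balls: `∫_{B(c,R)} k(x − c) = ∫_{B(0,R)} k`. [folklore] -/
theorem setLIntegral_ball_comp_sub (k : 𝔼 → ℝ≥0∞) (c : 𝔼) (R : ℝ) :
    ∫⁻ x in ball c R, k (x - c) = ∫⁻ x in ball (0 : 𝔼) R, k x := by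
  rw [← lintegral_indicator measurableSet_ball, ← lintegral_indicator measurableSet_ball]
  have e : (ball c R).indicator (fun x => k (x - c)) = fun x => (ball (0 : 𝔼) R).indicator k (x - c) := by
    funext x
    simp only [indicator, mem_ball, dist_eq_norm, sub_zero]
  rw [e]
  exact lintegral_sub_right_eq_self (μ := (volume : Measure 𝔼)) ((ball (0 : 𝔼) R).indicator k) c

/-- Translation invariance for kernel integrals over closed balls. [folklore] -/
theorem setLIntegral_closedBall_comp_sub (k : 𝔼 → ℝ≥0∞) (c : 𝔼) (R : ℝ) :
    ∫⁻ x in closedBall c R, k (x - c) = ∫⁻ x in closedBall (0 : 𝔼) R, k x := by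
  rw [← lintegral_indicator measurableSet_closedBall, ← lintegral_indicator measurableSet_closedBall]
  have e : (closedBall c R).indicator (fun x => k (x - c)) =
      fun x => (closedBall (0 : 𝔼) R).indicator k (x - c) := by
    funext x
    simp only [indicator, mem_closedBall, dist_eq_norm, sub_zero]
  rw [e]
  exact lintegral_sub_right_eq_self (μ := (volume : Measure 𝔼)) ((closedBall (0 : 𝔼) R).indicator k) c

/-- `∫_{B̄(c,R)} |x − c|^{-s} dx < ∞` for `s < 3`. [folklore] -/
theorem lintegral_closedBall_powKer_sub_lt_top {s : ℝ} (hs : s < 3) (c : 𝔼) (R : ℝ) :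
    ∫⁻ x in closedBall c R, powKer s (x - c) < ⊤ := by
  rw [setLIntegral_closedBall_comp_sub]
  exact lt_of_le_of_lt (lintegral_mono_set (closedBall_subset_ball (by linarith : R < R + 1)))
    (lintegral_ball_powKer_lt_top hs (R + 1))

/-- **`|x|^{-s}` is integrable off balls of `ℝ³` for `s > 3`** (comparison with
`(1 + |x|)^{-s}`, Mathlib's `finite_integral_one_add_norm`). [folklore] -/
theorem lintegral_compl_ball_powKer_lt_top {s : ℝ} (hs : 3 < s) {R : ℝ} (hR : 0 < R) :
    ∫⁻ x in (ball (0 : 𝔼) R)ᶜ, powKer s x < ⊤ := by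
  have hs0 : 0 ≤ s := by linarith
  set c : ℝ := ((1 + R) / R) ^ s with hc
  have hbound : ∀ x : 𝔼, x ∈ (ball (0 : 𝔼) R)ᶜ →
      powKer s x ≤ ENNReal.ofReal c * ENNReal.ofReal ((1 + ‖x‖) ^ (-s)) := by
    intro x hx
    have hxR : R ≤ ‖x‖ := by simpa using hx
    have hq : 0 < (1 + R) / R := by positivity
    rw [powKer, ← ENNReal.ofReal_mul (by positivity)]
    refine ENNReal.ofReal_le_ofReal ?_
    have h1 : 1 + ‖x‖ ≤ (1 + R) / R * ‖x‖ := by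
      rw [div_mul_eq_mul_div, le_div_iff₀ hR]
      nlinarith
    have h2 : ((1 + R) / R * ‖x‖) ^ (-s) ≤ (1 + ‖x‖) ^ (-s) :=
      Real.rpow_le_rpow_of_nonpos (by positivity) h1 (by linarith)
    rw [Real.mul_rpow hq.le (norm_nonneg _)] at h2
    calc ‖x‖ ^ (-s) = ((1 + R) / R) ^ s * (((1 + R) / R) ^ (-s) * ‖x‖ ^ (-s)) := by
          rw [← mul_assoc, ← Real.rpow_add hq, add_neg_cancel, Real.rpow_zero, one_mul]
      _ ≤ ((1 + R) / R) ^ s * (1 + ‖x‖) ^ (-s) := mul_le_mul_of_nonneg_left h2 (by positivity)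
      _ = c * (1 + ‖x‖) ^ (-s) := by rw [hc]
  have hfin : ∫⁻ x : 𝔼, ENNReal.ofReal ((1 + ‖x‖) ^ (-s)) < ⊤ :=
    finite_integral_one_add_norm (by rw [finrank_eq_three]; exact_mod_cast hs)
  calc ∫⁻ x in (ball (0 : 𝔼) R)ᶜ, powKer s x
      ≤ ∫⁻ x in (ball (0 : 𝔼) R)ᶜ, ENNReal.ofReal c * ENNReal.ofReal ((1 + ‖x‖) ^ (-s)) :=
        setLIntegral_mono' isOpen_ball.measurableSet.compl hbound
    _ ≤ ∫⁻ x, ENNReal.ofReal c * ENNReal.ofReal ((1 + ‖x‖) ^ (-s)) := setLIntegral_le_lintegral _ _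
    _ = ENNReal.ofReal c * ∫⁻ x : 𝔼, ENNReal.ofReal ((1 + ‖x‖) ^ (-s)) :=
        lintegral_const_mul' _ _ ENNReal.ofReal_ne_top
    _ < ⊤ := ENNReal.mul_lt_top ENNReal.ofReal_lt_top hfin

/-! ### Scaling -/

/-- **Scaling of Lebesgue integrals on `ℝ³`**: `∫ f(c x) dx = c⁻³ ∫ f` for `c > 0`. [folklore] -/
theorem lintegral_comp_smul (f : 𝔼 → ℝ≥0∞) {c : ℝ} (hc : 0 < c) :
    ∫⁻ x, f (c • x) = ENNReal.ofReal (c ^ 3)⁻¹ * ∫⁻ x, f x := by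
  have h1 : ∫⁻ x, f (c • x) ∂(volume : Measure 𝔼) =
      ∫⁻ y, f y ∂(Measure.map (fun x : 𝔼 => c • x) volume) :=
    (lintegral_map_equiv f
      (Homeomorph.smul ((isUnit_iff_ne_zero.2 hc.ne').unit : ℝˣ) : 𝔼 ≃ₜ 𝔼).toMeasurableEquiv).symm
  rw [h1, Measure.map_addHaar_smul volume hc.ne', lintegral_smul_measure, finrank_eq_three,
    abs_of_pos (by positivity), smul_eq_mul]

/-! ### The two-centre bound -/

/-- **The Riesz composition bound** (unit scale): for `0 ≤ a, b < 3` with `a + b > 3` there is a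
finite `K` with `∫ |u|^{-a} |u − e|^{-b} du ≤ K` for every unit vector `e`. (Split `ℝ³` into
`|u| ≤ ½`, `|u − e| ≤ ½` and the rest, where `|u − e| ≥ |u|/4`.) [folklore] -/
theorem exists_lintegral_powKer_mul_powKer_unit_le {a b : ℝ} (ha : 0 ≤ a) (ha3 : a < 3) (hb : 0 ≤ b)
    (hb3 : b < 3) (hab : 3 < a + b) :
    ∃ K : ℝ≥0∞, K < ⊤ ∧ ∀ e : 𝔼, ‖e‖ = 1 → ∫⁻ u, powKer a u * powKer b (u - e) ≤ K := by
  -- the three majorants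
  set K₁ := ENNReal.ofReal ((1 / 2 : ℝ) ^ (-b)) * ∫⁻ u in closedBall (0 : 𝔼) (1 / 2), powKer a u with hK₁
  set K₂ := ENNReal.ofReal ((1 / 2 : ℝ) ^ (-a)) * ∫⁻ u in closedBall (0 : 𝔼) (1 / 2), powKer b u with hK₂
  set K₃ := ENNReal.ofReal ((4 : ℝ) ^ b) * ∫⁻ u in (ball (0 : 𝔼) (1 / 2))ᶜ, powKer (a + b) u with hK₃
  have hK₁f : K₁ < ⊤ := ENNReal.mul_lt_top ENNReal.ofReal_lt_top
    (lt_of_le_of_lt (lintegral_mono_set (closedBall_subset_ball (by norm_num : (1/2 : ℝ) < 1)))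
      (lintegral_ball_powKer_lt_top ha3 1))
  have hK₂f : K₂ < ⊤ := ENNReal.mul_lt_top ENNReal.ofReal_lt_top
    (lt_of_le_of_lt (lintegral_mono_set (closedBall_subset_ball (by norm_num : (1/2 : ℝ) < 1)))
      (lintegral_ball_powKer_lt_top hb3 1))
  have hK₃f : K₃ < ⊤ := ENNReal.mul_lt_top ENNReal.ofReal_lt_top
    (lintegral_compl_ball_powKer_lt_top hab (by norm_num))
  refine ⟨K₁ + K₂ + K₃, ENNReal.add_lt_top.2 ⟨ENNReal.add_lt_top.2 ⟨hK₁f, hK₂f⟩, hK₃f⟩, fun e he => ?_⟩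
  -- pointwise domination by the sum of three functions
  set f₁ : 𝔼 → ℝ≥0∞ := fun u => (closedBall (0 : 𝔼) (1 / 2)).indicator
    (fun u => ENNReal.ofReal ((1 / 2 : ℝ) ^ (-b)) * powKer a u) u with hf₁
  set f₂ : 𝔼 → ℝ≥0∞ := fun u => (closedBall e (1 / 2)).indicator
    (fun u => ENNReal.ofReal ((1 / 2 : ℝ) ^ (-a)) * powKer b (u - e)) u with hf₂
  set f₃ : 𝔼 → ℝ≥0∞ := fun u => ((ball (0 : 𝔼) (1 / 2))ᶜ).indicator
    (fun u => ENNReal.ofReal ((4 : ℝ) ^ b) * powKer (a + b) u) u with hf₃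
  have hdom : ∀ u : 𝔼, powKer a u * powKer b (u - e) ≤ f₁ u + f₂ u + f₃ u := by
    intro u
    by_cases h1 : ‖u‖ ≤ 1 / 2
    · -- near the origin: `|u - e| ≥ 1/2`
      have hue : 1 / 2 ≤ ‖u - e‖ := by
        have := norm_sub_norm_le e u
        rw [he, norm_sub_rev] at this
        linarith
      have hle : powKer a u * powKer b (u - e) ≤ f₁ u := by
        rw [hf₁]
        simp only [indicator, mem_closedBall, dist_zero_right, h1, if_true]
        rw [mul_comm (ENNReal.ofReal _)]
        exact mul_le_mul' le_rfl (powKer_le_const hb (by norm_num) hue)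
      exact hle.trans (le_self_add.trans le_self_add)
    · by_cases h2 : ‖u - e‖ ≤ 1 / 2
      · -- near `e`: `|u| ≥ 1/2`
        have hu : 1 / 2 ≤ ‖u‖ := by linarith
        have hle : powKer a u * powKer b (u - e) ≤ f₂ u := by
          rw [hf₂]
          simp only [indicator, mem_closedBall, dist_eq_norm, h2, if_true]
          exact mul_le_mul' (powKer_le_const ha (by norm_num) hu) le_rfl
        exact hle.trans (le_add_self.trans le_self_add)
      · -- the rest: `|u - e| ≥ |u|/4`
        have hu : 1 / 2 < ‖u‖ := not_le.1 h1
        have hue : 1 / 2 < ‖u - e‖ := not_le.1 h2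
        have hu0 : u ≠ 0 := norm_pos_iff.1 (by linarith)
        have hq : ‖(4 : ℝ)⁻¹ • u‖ ≤ ‖u - e‖ := by
          rw [norm_smul, Real.norm_eq_abs, abs_of_pos (by norm_num : (0:ℝ) < 4⁻¹)]
          by_cases h3 : ‖u‖ ≤ 2
          · linarith
          · have := norm_sub_norm_le u e
            rw [he] at this
            linarith
        have hle : powKer a u * powKer b (u - e) ≤ f₃ u := by
          rw [hf₃]
          have hmem : u ∈ (ball (0 : 𝔼) (1 / 2))ᶜ := by
            simp only [mem_compl_iff, mem_ball, dist_zero_right, not_lt]; exact hu.le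
          simp only [indicator, hmem, if_true]
          have h4 : powKer b (u - e) ≤ powKer b ((4 : ℝ)⁻¹ • u) :=
            powKer_le_of_norm_le hb (smul_ne_zero (by norm_num) hu0) hq
          rw [powKer_smul (by norm_num) u, Real.inv_rpow (by norm_num), Real.rpow_neg (by norm_num),
            inv_inv] at h4
          calc powKer a u * powKer b (u - e) ≤ powKer a u * (ENNReal.ofReal ((4 : ℝ) ^ b) * powKer b u) :=
                mul_le_mul' le_rfl h4
            _ = ENNReal.ofReal ((4 : ℝ) ^ b) * (powKer a u * powKer b u) := by ring
            _ = ENNReal.ofReal ((4 : ℝ) ^ b) * powKer (a + b) u := by rw [powKer_mul_powKer hu0]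
        exact hle.trans le_add_self
  -- integrate
  have hm₁ : Measurable f₁ := ((measurable_powKer a).const_mul _).indicator measurableSet_closedBall
  have hm₂ : Measurable f₂ :=
    ((measurable_powKer_sub b e).const_mul _).indicator measurableSet_closedBall
  have i1 : ∫⁻ u, f₁ u = K₁ := by
    simp only [hf₁, lintegral_indicator measurableSet_closedBall]
    rw [lintegral_const_mul' _ _ ENNReal.ofReal_ne_top]
  have i2 : ∫⁻ u, f₂ u = K₂ := by
    simp only [hf₂, lintegral_indicator measurableSet_closedBall]
    rw [lintegral_const_mul' _ _ ENNReal.ofReal_ne_top, setLIntegral_closedBall_comp_sub]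
  have i3 : ∫⁻ u, f₃ u = K₃ := by
    simp only [hf₃, lintegral_indicator isOpen_ball.measurableSet.compl]
    rw [lintegral_const_mul' _ _ ENNReal.ofReal_ne_top]
  calc ∫⁻ u, powKer a u * powKer b (u - e) ≤ ∫⁻ u, (f₁ u + f₂ u + f₃ u) := lintegral_mono hdom
    _ = (∫⁻ u, f₁ u) + (∫⁻ u, f₂ u) + ∫⁻ u, f₃ u := by
        rw [lintegral_add_left (f := fun u => f₁ u + f₂ u) (hm₁.add hm₂), lintegral_add_left hm₁]
    _ = K₁ + K₂ + K₃ := by rw [i1, i2, i3]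

/-- **The two-centre Riesz bound**: for `0 ≤ a, b < 3`, `a + b > 3`,
`∫_{ℝ³} |x|^{-a} |x − w|^{-b} dx ≤ K |w|^{3−a−b}` for all `w ≠ 0` (scaling `x = |w| u` and the unit
bound). [folklore] -/
theorem exists_lintegral_powKer_mul_powKer_le {a b : ℝ} (ha : 0 ≤ a) (ha3 : a < 3) (hb : 0 ≤ b)
    (hb3 : b < 3) (hab : 3 < a + b) :
    ∃ K : ℝ≥0∞, K < ⊤ ∧ ∀ w : 𝔼, w ≠ 0 →
      ∫⁻ x, powKer a x * powKer b (x - w) ≤ K * ENNReal.ofReal (‖w‖ ^ (3 - a - b)) := by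
  obtain ⟨K, hK, hunit⟩ := exists_lintegral_powKer_mul_powKer_unit_le ha ha3 hb hb3 hab
  refine ⟨K, hK, fun w hw => ?_⟩
  set ρ := ‖w‖ with hρ
  have hρ0 : 0 < ρ := norm_pos_iff.2 hw
  set e : 𝔼 := ρ⁻¹ • w with he
  have he1 : ‖e‖ = 1 := by
    rw [he, norm_smul, Real.norm_eq_abs, abs_of_pos (inv_pos.2 hρ0), ← hρ, inv_mul_cancel₀ hρ0.ne']
  have hwe : w = ρ • e := by rw [he, smul_smul, mul_inv_cancel₀ hρ0.ne', one_smul]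
  -- scale `x = ρ • u`
  have hscale := lintegral_comp_smul (fun x => powKer a x * powKer b (x - w)) hρ0
  -- `∫ F = ρ³ ∫ F(ρ u) du`
  have h3 : ∫⁻ x, powKer a x * powKer b (x - w) =
      ENNReal.ofReal (ρ ^ 3) * ∫⁻ u, powKer a (ρ • u) * powKer b (ρ • u - w) := by
    rw [hscale, ← mul_assoc, ← ENNReal.ofReal_mul (by positivity), mul_inv_cancel₀ (by positivity),
      ENNReal.ofReal_one, one_mul]
  rw [h3]
  have h4 : ∀ u : 𝔼, powKer a (ρ • u) * powKer b (ρ • u - w) =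
      ENNReal.ofReal (ρ ^ (-a) * ρ ^ (-b)) * (powKer a u * powKer b (u - e)) := by
    intro u
    rw [hwe, ← smul_sub, powKer_smul hρ0, powKer_smul hρ0,
      ENNReal.ofReal_mul (Real.rpow_nonneg hρ0.le _)]
    ring
  simp_rw [h4]
  rw [lintegral_const_mul' _ _ ENNReal.ofReal_ne_top, ← mul_assoc, ← ENNReal.ofReal_mul (by positivity)]
  have h5 : ρ ^ 3 * (ρ ^ (-a) * ρ ^ (-b)) = ρ ^ (3 - a - b) := by
    rw [← Real.rpow_natCast ρ 3, ← Real.rpow_add hρ0, ← Real.rpow_add hρ0]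
    congr 1
    push_cast
    ring
  rw [h5, mul_comm]
  exact mul_le_mul' (hunit e he1) le_rfl

/-- **The bounded case**: for `0 < a, b` with `a + b < 3` and `R > 0`,
`∫_{B̄(c,R)} |x − c|^{-a} |x − w|^{-b} dx ≤ K` uniformly in `c` and `w ∈ B̄(c,R)` (Hölder with the
conjugate exponents `(a+b)/a`, `(a+b)/b`). [folklore] -/
theorem exists_setLIntegral_powKer_mul_powKer_le {a b : ℝ} (ha : 0 < a) (hb : 0 < b) (hab : a + b < 3)
    (R : ℝ) : ∃ K : ℝ≥0∞, K < ⊤ ∧ ∀ c w : 𝔼, w ∈ closedBall c R →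
      ∫⁻ x in closedBall c R, powKer a (x - c) * powKer b (x - w) ≤ K := by
  have hs0 : 0 < a + b := by positivity
  have ha0 : a ≠ 0 := ha.ne'
  have hb0 : b ≠ 0 := hb.ne'
  set t : ℝ := (a + b) / a with ht
  set t' : ℝ := (a + b) / b with ht'
  have htt : t.HolderConjugate t' := by
    refine Real.holderConjugate_iff.2 ⟨?_, ?_⟩
    · rw [ht, lt_div_iff₀ ha]; linarith
    · rw [ht, ht']; field_simp
  set L₁ := ∫⁻ x in closedBall (0 : 𝔼) R, powKer (a + b) x with hL₁
  set L₂ := ∫⁻ x in closedBall (0 : 𝔼) (2 * R), powKer (a + b) x with hL₂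
  have hL₁f : L₁ < ⊤ := by
    have := lintegral_closedBall_powKer_sub_lt_top hab (0 : 𝔼) R
    simpa using this
  have hL₂f : L₂ < ⊤ := by
    have := lintegral_closedBall_powKer_sub_lt_top hab (0 : 𝔼) (2 * R)
    simpa using this
  refine ⟨L₁ ^ (1 / t) * L₂ ^ (1 / t'), ENNReal.mul_lt_top (ENNReal.rpow_lt_top_of_nonneg (by positivity)
    hL₁f.ne) (ENNReal.rpow_lt_top_of_nonneg (by positivity) hL₂f.ne), fun c w hw => ?_⟩
  have hH := ENNReal.lintegral_mul_le_Lp_mul_Lq ((volume : Measure 𝔼).restrict (closedBall c R)) htt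
    ((measurable_powKer_sub a c).aemeasurable) ((measurable_powKer_sub b w).aemeasurable)
  refine hH.trans ?_
  have hat : a * t = a + b := by rw [ht]; field_simp
  have hbt : b * t' = a + b := by rw [ht']; field_simp
  gcongr
  · -- first factor
    simp_rw [powKer_rpow htt.nonneg, hat]
    rw [setLIntegral_closedBall_comp_sub]
  · -- second factor: enlarge the ball around `w`
    simp_rw [powKer_rpow htt.symm.nonneg, hbt]
    have hsub : closedBall c R ⊆ closedBall w (2 * R) := by
      intro x hx
      rw [mem_closedBall] at hx hw ⊢
      calc dist x w ≤ dist x c + dist c w := dist_triangle _ _ _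
        _ = dist x c + dist w c := by rw [dist_comm c w]
        _ ≤ R + R := add_le_add hx hw
        _ = 2 * R := by ring
    calc ∫⁻ x in closedBall c R, powKer (a + b) (x - w) ≤ ∫⁻ x in closedBall w (2 * R), powKer (a + b) (x - w) :=
          lintegral_mono_set hsub
      _ = L₂ := by rw [setLIntegral_closedBall_comp_sub]

end RieszKernel

end Literature.Analysis.FluidPDE
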